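import Mathlib
import Literature.Analysis.PDE.Wave1DNearChannelForward
import Literature.Analysis.PDE.Wave1DFluxBookkeeping
import Summits.FinalStateConjecture.FinalStateConjecture.Theorems.PhotonSphereChannelsNearKernel
import Summits.FinalStateConjecture.FinalStateConjecture.Theorems.PhotonSphereChannelsNearHardy

/-!
# Route PhotonSphereChannels, line `crum-peeling-recessive-tower` — the near half-line channel
# estimate, per mode, with its constants exposed

Helper for stub `stub_nearLogEdgeChannels` of crux `UniformPhotonSphereChannelsR`
(stmt-FinalStateConjecture-14074).  The landed per-mode theorem `Theorems.nearHalfLineChannels`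
(`PhotonSphereChannelsNearChannels.lean`) hides its witnesses behind `∃ ρ₀ ≥ 0, ∃ c > 0`; here the
SAME statement is proved with the witnesses written out:
`ρ₀(M, ℓ) = max 0 (2M log(25600 M² B e^{3/2M}))`, `B = (ℓ(ℓ+1)+1)/(2M)³ · e^{(r*(3M) − 2M)/2M}`
(`r* = efTortoiseCoord M`), and `c = 1/4`, so that the uniform (log-ball) near estimate can read off
`ρ₀(M, ℓ) ≤ ρ₀'(M) + 4M log(ℓ+1)` (`PhotonSphereChannelsUniformPhotonSphereChannelsRNearLogEdgeChannels.lean`).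
The proof is the landed proof verbatim (see that file's module docstring for the mathematics:
exponential tail of the potential, recessive static solution, Hardy, forward near-edge bound and
time reversal); only the quantifier prefix changed.
-/

noncomputable section

namespace Summit.FinalStateConjecture.FinalStateConjecture.Theorems.CrumPeelingRecessiveTower

open Literature.Analysis.ODE Literature.Analysis.PDE Literature.Analysis.Calculus
open Literature.Barriers.FinalStateConjecture MeasureTheory Real Set Filter Topology

set_option maxHeartbeats 400000 in
/-- **The near (horizon-side) half-line channel estimate, per mode, explicit constants**:
`Theorems.nearHalfLineChannels` with `ρ₀ = max 0 (2M log(25600 M² B e^{3/2M}))`,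
`B = (ℓ(ℓ+1)+1)/(2M)³ · e^{(r*(3M) − 2M)/2M}` and `c = 1/4` in place of `∃ ρ₀ ≥ 0, ∃ c > 0`:
for every tortoise radius function, every `ρ ≥ ρ₀` and every global `C²` solution `ψ` of the
spin-`s` Regge–Wheeler equation (`s ≤ 2`, `s ≤ ℓ`),
`(1/4) · inf_{p ∈ P_near(ρ)} E_{x < xc−ρ}[ψ − p](0) ≤ liminf_{+∞} E_near + liminf_{−∞} E_near`.
Stated on one line, in the inlined-`let` phrasing of the route item, as registered (sub-goal of
stmt-FinalStateConjecture-14074). -/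
theorem nearHalfLineChannels_explicit : ∀ M : ℝ, 0 < M → ∀ (s ℓ : ℕ), s ≤ 2 → s ≤ ℓ → ∀ (r : ℝ → ℝ) (xc : ℝ), (∀ x, 2 * M < r x) → (∀ x, HasDerivAt r (1 - 2 * M / r x) x) → r xc = 3 * M → ∀ ρ : ℝ, max 0 (2 * M * Real.log (25600 * M ^ 2 * (((ℓ : ℝ) * ((ℓ : ℝ) + 1) + 1) / (2 * M) ^ 3 * Real.exp ((Literature.Barriers.FinalStateConjecture.efTortoiseCoord M (3 * M) - 2 * M) / (2 * M))) * Real.exp (3 / (2 * M)))) ≤ ρ → ∀ ψ : ℝ → ℝ → ℝ, ContDiff ℝ 2 (Function.uncurry ψ) → let V : ℝ → ℝ := fun x => (1 - 2 * M / r x) * ((ℓ : ℝ) * ((ℓ : ℝ) + 1) / r x ^ 2 + (1 - (s : ℝ) ^ 2) * (2 * M) / r x ^ 3); let e : (ℝ → ℝ → ℝ) → ℝ → ℝ → ℝ := fun φ t x => deriv (fun τ => φ τ x) t ^ 2 + deriv (φ t) x ^ 2 + V x * φ t x ^ 2; let IsSol : (ℝ → ℝ → ℝ) → ℝ × ℝ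 → Prop := fun φ z => iteratedDeriv 2 (fun τ => φ τ z.2) z.1 - iteratedDeriv 2 (φ z.1) z.2 + V z.2 * φ z.1 z.2 = 0; let Ω : Set (ℝ × ℝ) := {z | z.2 < xc - ρ - |z.1|}; let P : Set (ℝ → ℝ → ℝ) := {p | ContDiffOn ℝ 2 (Function.uncurry p) Ω ∧ (∀ z ∈ Ω, IsSol p z) ∧ ∃ (N : ℕ) (a : ℕ → ℝ → ℝ), ∀ z ∈ Ω, p z.1 z.2 = ∑ i ∈ Finset.range N, a i z.2 * z.1 ^ i}; let Eext : ℝ → ENNReal := fun t => MeasureTheory.lintegral (MeasureTheory.volume.restrict (Set.Iio (xc - ρ - |t|))) (fun x => ENNReal.ofReal (e ψ t x)); (∀ z, IsSol ψ z) → ENNReal.ofReal (1 / 4) * (⨅ p ∈ P, MeasureTheory.lintegral (MeasureTheory.volume.restrict (Set.Iio (xc - ρ))) (fun x => ENNReal.ofReal (e (fun t y => ψ t y - p t y) 0 x))) ≤ Filter.liminf Eext Filter.atTop + Filter.liminf Eext Filter.atBot := by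
  intro M hM s ℓ hs hsℓ
  -- constants depending on `(M, ℓ)`
  set rstar : ℝ := efTortoiseCoord M (3 * M) with hrstar
  set B : ℝ := ((ℓ : ℝ) * ((ℓ : ℝ) + 1) + 1) / (2 * M) ^ 3 * exp ((rstar - 2 * M) / (2 * M)) with hBdef
  have hB0 : 0 < B := rwTailConst_pos hM ℓ
  intro r xc hr hr' hxc ρ hρ ψ hψ V e IsSol Ω P Eext hsol
  have hρ0 : 0 ≤ ρ := (le_max_left _ _).trans hρ
  set a : ℝ := xc - ρ with ha
  have h2M : 0 < 2 * M := by positivity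
  -- the potential
  have hrc : Continuous r := continuous_iff_continuousAt.2 fun x => (hr' x).continuousAt
  have hr0 : ∀ x, r x ≠ 0 := fun x => (lt_trans h2M (hr x)).ne'
  have hVc : Continuous V := by
    show Continuous fun x => (1 - 2 * M / r x) * ((ℓ : ℝ) * ((ℓ : ℝ) + 1) / r x ^ 2
      + (1 - (s : ℝ) ^ 2) * (2 * M) / r x ^ 3)
    exact (continuous_const.sub (continuous_const.div hrc hr0)).mul
      ((continuous_const.div (hrc.pow 2) fun x => pow_ne_zero 2 (hr0 x)).add
        (continuous_const.div (hrc.pow 3) fun x => pow_ne_zero 3 (hr0 x)))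
  have hV0 : ∀ x, 0 ≤ V x := fun x => rwPotential_nonneg hM (hr x) hs hsℓ
  have hVB : ∀ x, V x ≤ B * exp ((x - xc) / (2 * M)) := fun x =>
    rwPotential_tortoise_le_const_mul_exp hM hr hr' hxc s ℓ x
  have hsol' : ∀ t x, iteratedDeriv 2 (fun τ => ψ τ x) t - iteratedDeriv 2 (ψ t) x + V x * ψ t x = 0 :=
    fun t x => hsol (t, x)
  -- from here on the potential is used only through `hVc`, `hV0`, `hVB`, `hsol'`
  clear_value V
  -- the master smallness
  have hsmall : 4 * M ^ 2 * B * exp (3 / (2 * M)) * exp (-ρ / (2 * M)) ≤ 1 / 6400 :=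
    near_smallness hM hB0 hρ
  have hexp3 : exp ((a + 3 - xc) / (2 * M)) = exp (3 / (2 * M)) * exp (-ρ / (2 * M)) := by
    rw [← exp_add]; congr 1; rw [ha]; field_simp; ring
  have hexpa : exp ((a - xc) / (2 * M)) = exp (-ρ / (2 * M)) := by
    congr 1; rw [ha]; ring
  have hexp_le : exp (-ρ / (2 * M)) ≤ exp (3 / (2 * M)) * exp (-ρ / (2 * M)) :=
    le_mul_of_one_le_left (exp_pos _).le (one_le_exp (by positivity))
  have h4MB : 0 ≤ 4 * M ^ 2 * B := by positivity
  have hsmall' : 4 * M ^ 2 * B * exp (-ρ / (2 * M)) ≤ 1 / 6400 :=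
    calc 4 * M ^ 2 * B * exp (-ρ / (2 * M))
        ≤ 4 * M ^ 2 * B * (exp (3 / (2 * M)) * exp (-ρ / (2 * M))) :=
          mul_le_mul_of_nonneg_left hexp_le h4MB
      _ = 4 * M ^ 2 * B * exp (3 / (2 * M)) * exp (-ρ / (2 * M)) := by ring
      _ ≤ 1 / 6400 := hsmall
  -- tail integrals of `V`
  obtain ⟨hVi3, hIV3⟩ := integral_Iic_le_of_le_exp hM hVc hV0 hVB (a + 3)
  obtain ⟨hWi3, hIW3⟩ := integral_Iic_weight_le_of_le_exp hM hVc hV0 hVB (a + 3)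
  obtain ⟨hWia, hIWa⟩ := integral_Iic_weight_le_of_le_exp hM hVc hV0 hVB a
  rw [hexp3] at hIV3 hIW3
  rw [hexpa] at hIWa
  have hQ : (∫ y in Iic (a + 3), (a + 3 - y) * V y) ≤ 1 / 6400 := hIW3.trans (by nlinarith [hsmall])
  have hCV : (∫ y in Iic a, (a - y) * V y) ≤ 1 / 6400 := hIWa.trans hsmall'
  -- `K, μ` for the forward lemma, `σ² = 16 M² K ≤ 1/1600`
  set K : ℝ := B * exp (-ρ / (2 * M)) with hK
  have hK0 : 0 ≤ K := by positivity
  have hμ : (0 : ℝ) < 1 / (2 * M) := by positivity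
  have hVK : ∀ x ≤ a, V x ≤ K * exp (1 / (2 * M) * (x - a)) := by
    intro x _
    refine (hVB x).trans (le_of_eq ?_)
    have hexpeq : exp ((x - xc) / (2 * M)) = exp (-ρ / (2 * M)) * exp (1 / (2 * M) * (x - a)) := by
      rw [← Real.exp_add]; congr 1; rw [ha]; field_simp; ring
    rw [hexpeq, hK]; ring
  have hσ : (2 * Real.sqrt K / (1 / (2 * M))) ^ 2 = 16 * M ^ 2 * K := by
    rw [div_div_eq_mul_div, div_one, mul_pow, mul_pow, Real.sq_sqrt hK0]; ring
  have hσsmall : (2 * Real.sqrt K / (1 / (2 * M))) ^ 2 ≤ 1 / 1600 := by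
    rw [hσ, hK]; nlinarith [hsmall']
  -- the recessive static solution `U` on `(−∞, a + 3)` and its global extension
  obtain ⟨U, hU, hUabs, hUclose, hUder, hUderbd⟩ :=
    exists_isSchrodingerSol_recessive (A := a + 3) hVc hV0 hVi3 hWi3 (hQ.trans (by norm_num))
  have hUC2 : ContDiff ℝ 2 U := contDiff_two_of_isSchrodingerSol hU hVc
  have haA : a < a + 3 := by linarith
  have hUa : 1 / 2 ≤ U a := by
    have h1 := hUclose a haA
    have h2 : |U a - 1| ≤ 1 / 2 := h1.trans (by linarith [hQ])
    linarith [(abs_le.1 h2).1]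
  have hUa0 : U a ≠ 0 := by linarith
  -- `β`, the kernel element `p₀ = βU`, and `φ = ψ − βU`
  set β : ℝ := ψ 0 a / U a with hβ
  set p₀ : ℝ → ℝ → ℝ := fun _ x => β * U x with hp₀
  obtain ⟨hp₀C2, hp₀sol⟩ := static_isSol hU hVc β
  obtain ⟨hφC2, hφsol⟩ := sub_static_isSol (V := V) hψ hsol' hU hVc β
  -- `p₀` lies in the near kernel `P`
  have hp₀P : p₀ ∈ P := by
    refine ⟨hp₀C2.contDiffOn, fun z _ => hp₀sol z.1 z.2, 1, fun _ x => β * U x, fun z _ => ?_⟩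
    simp [hp₀]
  -- the initial deviation for `p₀` is the data energy of `φ`
  set dens : ℝ → ℝ := fun x => deriv (fun τ => ψ τ x - β * U x) 0 ^ 2
    + deriv (fun y => ψ 0 y - β * U y) x ^ 2 + V x * (ψ 0 x - β * U x) ^ 2 with hdens
  have hdens_c : Continuous dens :=
    (continuous_wave1D_energyDensity hVc hφC2).comp (continuous_const.prodMk continuous_id)
  have hdens_nn : ∀ x, 0 ≤ dens x := fun x =>
    wave1D_energyDensity_nonneg (ψ := fun t x => ψ t x - β * U x) hV0 0 x
  have hI0 : (∫⁻ x in Iio a, ENNReal.ofReal (e (fun t y => ψ t y - p₀ t y) 0 x))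
      = ∫⁻ x in Iio a, ENNReal.ofReal (dens x) := rfl
  have hinf_le : (⨅ p ∈ P, ∫⁻ x in Iio a, ENNReal.ofReal (e (fun t y => ψ t y - p t y) 0 x))
      ≤ ∫⁻ x in Iio a, ENNReal.ofReal (dens x) := by
    rw [← hI0]
    exact iInf₂_le p₀ hp₀P
  -- the derivative of `U` is exponentially small on `(−∞, a]`
  have hUder_le : ∀ x ≤ a, (deriv U x) ^ 2 ≤ (4 * M * B) ^ 2 * exp ((x - xc) / (2 * (M / 2))) := by
    intro x hx
    have hx3 : x < a + 3 := by linarith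
    obtain ⟨_, hIVx⟩ := integral_Iic_le_of_le_exp hM hVc hV0 hVB x
    have h1 : |deriv U x| ≤ 4 * M * B * exp ((x - xc) / (2 * M)) :=
      (hUderbd x hx3).trans ((mul_le_mul_of_nonneg_left hIVx (by norm_num)).trans_eq (by ring))
    have h2 : exp ((x - xc) / (2 * (M / 2))) = exp ((x - xc) / (2 * M)) ^ 2 := by
      rw [← Real.exp_nat_mul]; congr 1; push_cast; field_simp
    rw [h2, ← mul_pow]
    exact sq_le_sq' (by linarith [(abs_le.1 h1).1]) (abs_le.1 h1).2
  have hM2 : 0 < M / 2 := by positivity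
  obtain ⟨hEi2, -⟩ := integral_Iic_exp_tail hM2 a xc
  -- case split on finiteness of the data energy
  rcases eq_or_lt_of_le (le_top : (∫⁻ x in Iio a, ENNReal.ofReal (dens x)) ≤ ⊤) with htop | hfin
  · ----------------------------------------------------------------
    -- INFINITE ENERGY: the channel energy is `⊤` at every time
    ----------------------------------------------------------------
    -- `e[ψ − βU] ≤ 2 e[ψ] + 2 e[βU]` and `e[βU]` has finite integral on `(−∞, a)`
    set eψ : ℝ → ℝ := fun x => deriv (fun τ => ψ τ x) 0 ^ 2 + deriv (ψ 0) x ^ 2 + V x * ψ 0 x ^ 2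
      with heψ
    set eU : ℝ → ℝ := fun x => (β * deriv U x) ^ 2 + V x * (β * U x) ^ 2 with heU
    have hψd0 : ∀ x, DifferentiableAt ℝ (fun τ => ψ τ x) 0 := fun x =>
      ((hψ.comp (contDiff_id.prodMk contDiff_const)).differentiable (by norm_num)) 0
    have hψdx : ∀ x, DifferentiableAt ℝ (ψ 0) x := fun x =>
      ((hψ.comp (contDiff_const.prodMk contDiff_id)).differentiable (by norm_num)) x
    have hUd : ∀ x, DifferentiableAt ℝ (fun y => β * U y) x := fun x =>
      ((hU.differentiable x).const_mul β)
    have hpt : ∀ x, dens x ≤ 2 * eψ x + 2 * eU x := by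
      intro x
      simp only [hdens, heψ, heU]
      rw [deriv_sub_const, deriv_fun_sub (hψdx x) (hUd x), deriv_const_mul _ (hU.differentiable x)]
      have hV0x := hV0 x
      have i1 := sub_sq_le_two_mul (deriv (ψ 0) x) (β * deriv U x)
      have i2 := mul_le_mul_of_nonneg_left (sub_sq_le_two_mul (ψ 0 x) (β * U x)) hV0x
      have i3 : deriv (fun τ => ψ τ x) 0 ^ 2 ≤ 2 * deriv (fun τ => ψ τ x) 0 ^ 2 := by
        linarith only [sq_nonneg (deriv (fun τ => ψ τ x) 0)]
      linarith only [i1, i2, i3]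
    have heUi : IntegrableOn eU (Iic a) := by
      have hdom : IntegrableOn (fun x => β ^ 2 * ((4 * M * B) ^ 2 * exp ((x - xc) / (2 * (M / 2))))
          + 4 * β ^ 2 * V x) (Iic a) :=
        ((hEi2.const_mul _).const_mul _).add ((hVi3.mono_set (Iic_subset_Iic.2 haA.le)).const_mul _)
      refine Integrable.mono' hdom ?_ (ae_restrict_of_forall_mem measurableSet_Iic fun x hx => ?_)
      · exact (((hUC2.continuous_deriv (by norm_num)).const_mul β).pow 2 |>.add
          (hVc.mul ((hU.continuous.const_mul β).pow 2))).aestronglyMeasurable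
      · have hx3 : x < a + 3 := lt_of_le_of_lt hx haA
        have hUx : |U x| ≤ 2 := hUabs x hx3
        have hUx2 : U x ^ 2 ≤ 4 :=
          (sq_le_sq' (abs_le.1 hUx).1 (abs_le.1 hUx).2).trans_eq (by norm_num)
        have hV0x := hV0 x
        have heU0 : 0 ≤ eU x := by
          simp only [heU]; exact add_nonneg (sq_nonneg _) (mul_nonneg hV0x (sq_nonneg _))
        rw [Real.norm_eq_abs, abs_of_nonneg heU0]
        simp only [heU]
        calc (β * deriv U x) ^ 2 + V x * (β * U x) ^ 2
            = β ^ 2 * deriv U x ^ 2 + β ^ 2 * (V x * U x ^ 2) := by ring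
          _ ≤ β ^ 2 * ((4 * M * B) ^ 2 * exp ((x - xc) / (2 * (M / 2)))) + β ^ 2 * (V x * 4) :=
              add_le_add (mul_le_mul_of_nonneg_left (hUder_le x hx) (sq_nonneg β))
                (mul_le_mul_of_nonneg_left (mul_le_mul_of_nonneg_left hUx2 hV0x) (sq_nonneg β))
          _ = β ^ 2 * ((4 * M * B) ^ 2 * exp ((x - xc) / (2 * (M / 2)))) + 4 * β ^ 2 * V x := by
              ring
    have heU_fin : (∫⁻ x in Iio a, ENNReal.ofReal (eU x)) < ⊤ := by
      refine lt_of_le_of_lt (lintegral_mono_set Iio_subset_Iic_self) ?_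
      exact heUi.lintegral_lt_top
    -- hence the initial energy of `ψ` on `(−∞, a)` is infinite
    have hψtop : (∫⁻ x in Iio a, ENNReal.ofReal (eψ x)) = ⊤ := by
      by_contra hne
      have hlt : (∫⁻ x in Iio a, ENNReal.ofReal (eψ x)) < ⊤ := lt_top_iff_ne_top.2 hne
      have hbound : (∫⁻ x in Iio a, ENNReal.ofReal (dens x))
          ≤ 2 * (∫⁻ x in Iio a, ENNReal.ofReal (eψ x)) + 2 * ∫⁻ x in Iio a, ENNReal.ofReal (eU x) := by
        have heψm : Measurable fun x => ENNReal.ofReal (eψ x) :=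
          ENNReal.measurable_ofReal.comp ((continuous_wave1D_energyDensity hVc hψ).comp
            (continuous_const.prodMk continuous_id)).measurable
        have heUm : Measurable fun x => ENNReal.ofReal (eU x) :=
          ENNReal.measurable_ofReal.comp ((((hUC2.continuous_deriv (by norm_num)).const_mul β).pow 2
            |>.add (hVc.mul ((hU.continuous.const_mul β).pow 2))).measurable)
        calc (∫⁻ x in Iio a, ENNReal.ofReal (dens x))
            ≤ ∫⁻ x in Iio a, (2 * ENNReal.ofReal (eψ x) + 2 * ENNReal.ofReal (eU x)) := by
              refine lintegral_mono fun x => ?_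
              have heψ0 : 0 ≤ eψ x := wave1D_energyDensity_nonneg hV0 0 x
              have heU0 : 0 ≤ eU x := by simp only [heU]; have := hV0 x; positivity
              calc ENNReal.ofReal (dens x) ≤ ENNReal.ofReal (2 * eψ x + 2 * eU x) :=
                    ENNReal.ofReal_le_ofReal (hpt x)
                _ = 2 * ENNReal.ofReal (eψ x) + 2 * ENNReal.ofReal (eU x) := by
                    rw [ENNReal.ofReal_add (by positivity) (by positivity),
                      ENNReal.ofReal_mul (by norm_num), ENNReal.ofReal_mul (by norm_num)]
                    simp
          _ = 2 * (∫⁻ x in Iio a, ENNReal.ofReal (eψ x)) + 2 * ∫⁻ x in Iio a, ENNReal.ofReal (eU x) := by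
              rw [lintegral_add_left (heψm.const_mul 2), lintegral_const_mul 2 heψm,
                lintegral_const_mul 2 heUm]
      rw [htop] at hbound
      exact absurd hbound (not_le.2 (ENNReal.add_lt_top.2 ⟨ENNReal.mul_lt_top (by simp) hlt,
        ENNReal.mul_lt_top (by simp) heU_fin⟩))
    have hEn : ∀ t, Eext t = ⊤ := fun t =>
      wave1D_nearEnergy_eq_top_of_initial_eq_top hVc hV0 hψ hsol' hψtop t
    have hlim : liminf Eext atTop = ⊤ := by
      rw [show Eext = fun _ => ⊤ from funext hEn]; exact liminf_const ⊤
    calc ENNReal.ofReal (1 / 4) * (⨅ p ∈ P, ∫⁻ x in Iio a, ENNReal.ofReal (e (fun t y => ψ t y - p t y) 0 x))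
        ≤ ⊤ := le_top
      _ = liminf Eext atTop + liminf Eext atBot := by rw [hlim, top_add]
  · ----------------------------------------------------------------
    -- FINITE ENERGY: the perturbative argument
    ----------------------------------------------------------------
    obtain ⟨hEi, hEq⟩ := integrableOn_of_lintegral_lt_top hdens_c hdens_nn hfin
    set EV : ℝ := ∫ x in Iic a, dens x with hEVdef
    have hEV0 : 0 ≤ EV := setIntegral_nonneg measurableSet_Iic fun x _ => hdens_nn x
    -- the static part `q = βU`
    have hqC1 : ContDiff ℝ 1 (fun x => β * U x) := (contDiff_const.mul hUC2).of_le (by norm_num)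
    have hdq : ∀ x, deriv (fun y => β * U y) x = β * deriv U x := fun x =>
      deriv_const_mul β (hU.differentiable x)
    have hqi : IntegrableOn (fun x => deriv (fun y => β * U y) x ^ 2) (Iic a) := by
      have hdom : IntegrableOn (fun x => β ^ 2 * ((4 * M * B) ^ 2 * exp ((x - xc) / (2 * (M / 2)))))
          (Iic a) := (hEi2.const_mul _).const_mul _
      refine Integrable.mono' hdom ?_ (ae_restrict_of_forall_mem measurableSet_Iic fun x hx => ?_)
      · have : Continuous fun x => deriv (fun y => β * U y) x := by
          simp only [hdq]; exact (hUC2.continuous_deriv (by norm_num)).const_mul β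
        exact (this.pow 2).aestronglyMeasurable
      · rw [Real.norm_eq_abs, abs_of_nonneg (sq_nonneg _), hdq, mul_pow]
        exact mul_le_mul_of_nonneg_left (hUder_le x hx) (sq_nonneg β)
    set S : ℝ := (2 * Real.sqrt K / (1 / (2 * M))) ^ 2 with hS
    -- names for the data integrals
    set Hf : ℝ → ℝ := fun x => deriv (fun y => ψ 0 y - β * U y) x with hHf
    set Gf : ℝ → ℝ := fun x => deriv (fun τ => ψ τ x - β * U x) 0 with hGf
    set Ip : ℝ := ∫ x in Iic a, (Hf x + Gf x) ^ 2 / 2 with hIp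
    set Im : ℝ := ∫ x in Iic a, (Hf x - Gf x) ^ 2 / 2 with hIm
    ------------------------------------------------------------
    -- forward bound
    ------------------------------------------------------------
    have hfwd := wave1D_near_liminf_ge (ψ := ψ) (φ := fun t x => ψ t x - β * U x)
      (q := fun x => β * U x) hVc hV0 hK0 hμ hVK hψ hφC2 hφsol hqC1 (fun t x => by ring) hqi hEi
      (η := 1 / 4) (by norm_num)
    have hfwd' : ENNReal.ofReal (Ip / (1 + 1 / 4) ^ 2 - 4 * S * EV / (1 / 4 * (1 + 1 / 4)))
        ≤ liminf Eext atTop := hfwd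
    ------------------------------------------------------------
    -- backward bound: the forward bound for `ψ(−t, ·)`
    ------------------------------------------------------------
    obtain ⟨hψrC2, hψrsol, hψre⟩ := wave1D_timeReversal hψ hsol'
    obtain ⟨hφrC2, hφrsol, hφre⟩ := wave1D_timeReversal hφC2 hφsol
    have hGneg : ∀ x, deriv (fun τ => ψ (-τ) x - β * U x) 0 = -Gf x := fun x => by
      rw [hGf, deriv_sub_const]
      show deriv (fun τ => ψ (-τ) x) 0 = -deriv (fun τ => ψ τ x - β * U x) 0
      rw [deriv_sub_const, deriv_comp_neg (fun τ => ψ τ x) 0, neg_zero]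
    have hEir : IntegrableOn (fun x => deriv (fun τ => ψ (-τ) x - β * U x) 0 ^ 2
        + deriv (fun y => ψ (-0) y - β * U y) x ^ 2 + V x * (ψ (-0) x - β * U x) ^ 2) (Iic a) := by
      refine hEi.congr_fun (fun x _ => ?_) measurableSet_Iic
      simp only [hdens, hGneg, neg_zero, even_two.neg_pow, hGf]
    have hbwd := wave1D_near_liminf_ge (ψ := fun t x => ψ (-t) x)
      (φ := fun t x => ψ (-t) x - β * U x) (q := fun x => β * U x) hVc hV0 hK0 hμ hVK hψrC2 hφrC2
      hφrsol hqC1 (fun t x => by ring) hqi hEir (η := 1 / 4) (by norm_num)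
    have hR1 : (∫ x in Iic a, (deriv (fun x => ψ (-0) x - β * U x) x
        + deriv (fun τ => ψ (-τ) x - β * U x) 0) ^ 2 / 2) = Im := by
      refine setIntegral_congr_fun measurableSet_Iic fun x _ => ?_
      simp only [hHf, hGf, hGneg, neg_zero]; ring
    have hR2 : (∫ x in Iic a, (deriv (fun τ => ψ (-τ) x - β * U x) 0 ^ 2
        + deriv (fun x => ψ (-0) x - β * U x) x ^ 2 + V x * (ψ (-0) x - β * U x) ^ 2)) = EV := by
      refine setIntegral_congr_fun measurableSet_Iic fun x _ => ?_
      simp only [hdens, hGneg, neg_zero, even_two.neg_pow, hGf]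
    have key : liminf (fun t => ∫⁻ x in Iio (a - |t|), ENNReal.ofReal
        (deriv (fun τ => ψ (-τ) x) t ^ 2 + deriv (fun x => ψ (-t) x) x ^ 2 + V x * ψ (-t) x ^ 2)) atTop
        = liminf Eext atBot := by
      have hfun : (fun t => ∫⁻ x in Iio (a - |t|), ENNReal.ofReal
          (deriv (fun τ => ψ (-τ) x) t ^ 2 + deriv (fun x => ψ (-t) x) x ^ 2 + V x * ψ (-t) x ^ 2))
          = fun t => Eext (-t) := by
        funext t
        show _ = ∫⁻ x in Iio (xc - ρ - |-t|), ENNReal.ofReal (e ψ (-t) x)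
        simp only [hψre, abs_neg]
        rfl
      rw [hfun, liminf_neg_atTop]
    rw [hR1, hR2, key] at hbwd
    ------------------------------------------------------------
    -- the free energy of the data and Hardy
    ------------------------------------------------------------
    have hHc : Continuous Hf := by
      have := (continuous_wave1D_energyDensity hVc hφC2)  -- only to have the partials continuous
      obtain ⟨φt, φx, -, -, -, -, hcx, -, -, -, h1, h2, -⟩ := exists_partials_of_contDiff_two hφC2
      have : Hf = fun x => φx 0 x := funext fun x => (h2 0 x).deriv
      rw [this]; exact hcx.comp (continuous_const.prodMk continuous_id)
    have hGc : Continuous Gf := by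
      obtain ⟨φt, φx, -, -, -, hct, -, -, -, -, h1, -, -⟩ := exists_partials_of_contDiff_two hφC2
      have : Gf = fun x => φt 0 x := funext fun x => (h1 0 x).deriv
      rw [this]; exact hct.comp (continuous_const.prodMk continuous_id)
    have hdens_eq : ∀ x, dens x = Gf x ^ 2 + Hf x ^ 2 + V x * (ψ 0 x - β * U x) ^ 2 := fun x => rfl
    have hdom_of_le : ∀ {f : ℝ → ℝ}, Continuous f → (∀ x, 0 ≤ f x) → (∀ x, f x ≤ dens x) →
        IntegrableOn f (Iic a) := fun hf hf0 hfle =>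
      Integrable.mono' hEi hf.aestronglyMeasurable (ae_of_all _ fun x => by
        rw [Real.norm_eq_abs, abs_of_nonneg (hf0 x)]; exact hfle x)
    have hVh0 : ∀ x, 0 ≤ V x * (ψ 0 x - β * U x) ^ 2 := fun x => mul_nonneg (hV0 x) (sq_nonneg _)
    have hIpi : IntegrableOn (fun x => (Hf x + Gf x) ^ 2 / 2) (Iic a) :=
      hdom_of_le ((hHc.add hGc).pow 2 |>.div_const 2) (fun x => by positivity) fun x => by
        rw [hdens_eq]; nlinarith only [sq_nonneg (Hf x - Gf x), hVh0 x]
    have hImi : IntegrableOn (fun x => (Hf x - Gf x) ^ 2 / 2) (Iic a) :=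
      hdom_of_le ((hHc.sub hGc).pow 2 |>.div_const 2) (fun x => by positivity) fun x => by
        rw [hdens_eq]; nlinarith only [sq_nonneg (Hf x + Gf x), hVh0 x]
    have hH2i : IntegrableOn (fun x => Hf x ^ 2) (Iic a) :=
      hdom_of_le (hHc.pow 2) (fun x => sq_nonneg _) fun x => by
        rw [hdens_eq]; nlinarith only [sq_nonneg (Gf x), hVh0 x]
    have hG2i : IntegrableOn (fun x => Gf x ^ 2) (Iic a) :=
      hdom_of_le (hGc.pow 2) (fun x => sq_nonneg _) fun x => by
        rw [hdens_eq]; nlinarith only [sq_nonneg (Hf x), hVh0 x]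
    have hVhi : IntegrableOn (fun x => V x * (ψ 0 x - β * U x) ^ 2) (Iic a) :=
      hdom_of_le (hVc.mul ((hφC2.continuous.comp (continuous_const.prodMk continuous_id)).pow 2))
        hVh0 fun x => by rw [hdens_eq]; nlinarith only [sq_nonneg (Gf x), sq_nonneg (Hf x)]
    set Ef : ℝ := ∫ x in Iic a, (Hf x ^ 2 + Gf x ^ 2) with hEf
    have hsum : Ip + Im = Ef := by
      rw [hIp, hIm, ← integral_add hIpi hImi, hEf]
      refine setIntegral_congr_fun measurableSet_Iic fun x _ => ?_
      ring
    -- Hardy with `h = ψ(0,·) − βU`, `h(a) = 0`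
    have hh0 : ψ 0 a - β * U a = 0 := by
      rw [hβ, div_mul_cancel₀ _ hUa0]; ring
    have hhC1 : ContDiff ℝ 1 (fun y => ψ 0 y - β * U y) :=
      ((hφC2.comp (contDiff_const.prodMk contDiff_id)).of_le (by norm_num))
    have hHardy : (∫ x in Iic a, V x * (ψ 0 x - β * U x) ^ 2) ≤ 1 / 6400 * ∫ x in Iic a, Hf x ^ 2 :=
      setIntegral_Iic_hardy hVc hV0 hWia hCV hhC1 hh0 hH2i hVhi
    have hHG2i : IntegrableOn (fun x => Hf x ^ 2 + Gf x ^ 2) (Iic a) := hH2i.add hG2i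
    have hEV_split : EV = Ef + ∫ x in Iic a, V x * (ψ 0 x - β * U x) ^ 2 := by
      rw [hEVdef, hEf, ← integral_add hHG2i hVhi]
      refine setIntegral_congr_fun measurableSet_Iic fun x _ => ?_
      rw [hdens_eq]; ring
    have hH2_le : (∫ x in Iic a, Hf x ^ 2) ≤ Ef := by
      rw [hEf]
      exact setIntegral_mono_on hH2i (hH2i.add hG2i) measurableSet_Iic fun x _ => by
        nlinarith only [sq_nonneg (Gf x)]
    have hHardy' : EV ≤ (1 + 1 / 6400) * Ef := by rw [hEV_split]; linarith only [hHardy, hH2_le]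
    ------------------------------------------------------------
    -- conclusion
    ------------------------------------------------------------
    have harith := near_final_arith (Ip := Ip) (Im := Im) hEV0 hσsmall hsum hHardy'
    calc ENNReal.ofReal (1 / 4) * (⨅ p ∈ P, ∫⁻ x in Iio a, ENNReal.ofReal (e (fun t y => ψ t y - p t y) 0 x))
        ≤ ENNReal.ofReal (1 / 4) * ENNReal.ofReal EV := by
          gcongr
          exact hinf_le.trans_eq hEq.symm
      _ = ENNReal.ofReal (EV / 4) := by
          rw [← ENNReal.ofReal_mul (by norm_num)]; ring_nf
      _ ≤ ENNReal.ofReal ((Ip / (1 + 1 / 4) ^ 2 - 4 * S * EV / (1 / 4 * (1 + 1 / 4)))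
          + (Im / (1 + 1 / 4) ^ 2 - 4 * S * EV / (1 / 4 * (1 + 1 / 4)))) :=
          ENNReal.ofReal_le_ofReal harith
      _ ≤ ENNReal.ofReal (Ip / (1 + 1 / 4) ^ 2 - 4 * S * EV / (1 / 4 * (1 + 1 / 4)))
          + ENNReal.ofReal (Im / (1 + 1 / 4) ^ 2 - 4 * S * EV / (1 / 4 * (1 + 1 / 4))) :=
          ENNReal.ofReal_add_le
      _ ≤ liminf Eext atTop + liminf Eext atBot := add_le_add hfwd' hbwd

end Summit.FinalStateConjecture.FinalStateConjecture.Theorems.CrumPeelingRecessiveTower
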